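import Mathlib
import HarnessLib
import Summits.ResolutionOfSingularities.ResolutionOfSingularities.Theorems.HomologicalConductorNoZenoStableAnnihilatorReduction
import Summits.ResolutionOfSingularities.ResolutionOfSingularities.Theorems.HomologicalConductorPersistenceQuotientHypersurfaceSaturation
import Literature.RingTheory.CohomologyAnnihilator.Localization

/-!
# Crux `Persistence` (stmt-ResolutionOfSingularities-16484), chain W4.4b — §H2L «KEPT PROPER»:
# the JACOBIAN ideal of a hypersurface lies in `caᵈ⁺¹(R ⧸ (f))`

Route `ResolutionOfSingularities/HomologicalConductor`.  OURS (cell res-hironaka, crux chain W4.4b,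
CRUX-PLAN w44b v12 §4.3 / v11.1a §H2L «KEPT(x ∈ ca(T)) proper»; seat res-D-pv-058); nothing here is
a statement of the manuscript under review (Hironaka 2017); AI-written, weaker than expert review.

`R` a commutative ring, `f ∈ R`, `T := R ⧸ (f)`, `D` a derivation of `R` (over any base ring `A`).

* **The basis-free Eisenbud operator** `stablyAnnihilates_derivation_of_presentation`: for a
  `T`-module `K` and an `R`-linear surjection `p : Rⁿ ↠ K` whose kernel `F₁` is finitely generated
  PROJECTIVE (`pd_R K ≤ 1`), the class of `D f` STABLY ANNIHILATES `K`
  (`NoZeno.SandwichCluster.StablyAnnihilates`).  Proof: with `∇` the coordinatewise action of `D`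
  on `Rⁿ`, the «second fundamental form» `θ : F₁ → K`, `u ↦ p (∇ u)`, is `R`-LINEAR
  (`p (∇ (r u)) = D r • p u + r • p (∇ u)` and `p u = 0`), hence kills `f F₁` (`f K = 0`) and extends
  to `θ̄ : T ⊗_R F₁ → K`; the map `ι : K → T ⊗_R F₁`, `p v ↦ 1 ⊗ (f v)` (well defined: `1 ⊗ f u =
  f̄ • (1 ⊗ u) = 0` for `u ∈ F₁`) satisfies `θ̄ (ι (p v)) = p (∇ (f v)) = D f • p v`, i.e.
  `θ̄ ∘ ι = (D f)‾ • 𝟙_K` through the finitely generated projective `T`-module `T ⊗_R F₁`.  No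
  matrices, no free complement, no noetherian hypothesis, `f` arbitrary.  (For `K = coker φ̄` of a
  square matrix factorisation this is U7b `PersistenceStableAnnihilatorMF.stablyAnnihilates_coker_derivation`.)
* `stablyAnnihilates_derivation_of_hasProjectiveDimensionLT_two`: `R` noetherian, `K` a finitely
  generated `T`-module with `pd_R K ≤ 1` ⇒ `(D f)‾` stably annihilates `K`.
* **`derivation_mem_cohomologyAnnihilatorOfDegree`**: `R` noetherian with `caᵈ⁺²(R) = R` (every
  finitely generated module has `pd ≤ d + 1`: regular rings of dimension `≤ d + 1`), `f` a
  non-zero-divisor ⇒ **`(D f)‾ ∈ caᵈ⁺¹(R ⧸ (f))`** (o9g dimension shifting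
  `QuotientHypersurfaceSaturation.hasProjectiveDimensionLT_restrict_of_isSyzygy`: `d`-th `T`-syzygies
  have `pd_R ≤ 1`; then CA1 `mem_cohomologyAnnihilatorOfDegree_succ_iff_forall_isSyzygy`); the
  `ca`-form, the ideal form `span {(Dᵢ f)‾} ≤ caᵈ⁺¹(T)` («Jacobian ⊆ ca» for hypersurfaces), and the
  corollaries for `R` regular / regular local of dimension `d + 1`, and the affine case
  `pderiv_mem_cohomologyAnnihilatorOfDegree` / `jacobian_le_cohomologyAnnihilatorOfDegree`
  (`S = k[X₀,…,X_d]`, `f ≠ 0`: `(∂f/∂Xᵢ)‾ ∈ caᵈ⁺¹(S ⧸ (f))`).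

This is the `⊇` half of §H2L «CENTRE EXACTLY» (`ca(T) ⊇ (∂f)·T`) for every hypersurface stage at
once.  References (mechanism only): D. Eisenbud, Trans. AMS 260 (1980) §5–6 (operators on matrix
factorisations); S. B. Iyengar, R. Takahashi, arXiv:1404.1476 §2 [`IyengarTakahashi2014`];
classical: the Jacobian ideal annihilates `Ext^{>dim}` over a hypersurface.  All `[folklore]`.
-/

noncomputable section

-- single-problem summit: the doubled namespace component `ResolutionOfSingularities` is forced
set_option linter.dupNamespace false

open CategoryTheory TensorProduct Literature.RingTheory.CohomologyAnnihilator
open Summit.ResolutionOfSingularities.ResolutionOfSingularities.Theorems.NoZeno.SandwichCluster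
open Summit.ResolutionOfSingularities.ResolutionOfSingularities.Theorems.HomologicalConductor.QuotientHypersurfaceSaturation
open scoped TensorProduct

universe u

namespace Summit.ResolutionOfSingularities.ResolutionOfSingularities.Theorems.HomologicalConductor.PersistenceJacobianKept

variable {R : Type u} [CommRing R] {A : Type*} [CommRing A] [Algebra A R]

/-! ## The basis-free Eisenbud operator -/

/-- Coordinatewise Leibniz rule on `ι → R`: `∇ (r • v) = D r • v + r • ∇ v` for
`∇ v = fun i => D (v i)`. [folklore] -/
theorem coord_derivation_smul (D : Derivation A R R) {ι : Type} (r : R) (v : ι → R) :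
    (fun i => D ((r • v) i)) = D r • v + r • fun i => D (v i) := by
  funext i
  simp only [Pi.smul_apply, smul_eq_mul, Derivation.leibniz, Pi.add_apply]
  ring

/-- An element of the `R ⧸ (f)`-module `K` is killed by `f`. [folklore] -/
theorem smul_eq_zero_of_quotient (f : R) {K : Type*} [AddCommGroup K] [Module R K]
    [Module (R ⧸ Ideal.span {f}) K] [IsScalarTower R (R ⧸ Ideal.span {f}) K] (k : K) :
    f • k = 0 := by
  rw [← IsScalarTower.algebraMap_smul (R ⧸ Ideal.span {f}) f k, Ideal.Quotient.algebraMap_eq,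
    Ideal.Quotient.eq_zero_iff_mem.mpr (Ideal.mem_span_singleton_self f), zero_smul]

/-- **The basis-free Eisenbud operator.**  `T = R ⧸ (f)`, `K` a `T`-module, `p : (ι → R) ↠ K` an
`R`-linear surjection from a free module whose kernel `F₁` is finitely generated projective, `D` a
derivation of `R`.  Then the class of `D f` stably annihilates `K`: `(D f)‾ • 𝟙_K = θ̄ ∘ ι` factors
through the finitely generated projective `T`-module `T ⊗_R F₁`, where `θ̄` extends the `R`-linear
second fundamental form `θ : F₁ → K`, `u ↦ p (∇ u)`, and `ι (p v) = 1 ⊗ f v`.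
[folklore; mechanism: Eisenbud 1980 §5] -/
theorem stablyAnnihilates_derivation_of_presentation (D : Derivation A R R) (f : R)
    (K : Type u) [AddCommGroup K] [Module R K] [Module (R ⧸ Ideal.span {f}) K]
    [IsScalarTower R (R ⧸ Ideal.span {f}) K] {ι : Type} (p : (ι → R) →ₗ[R] K)
    (hp : Function.Surjective p) [Module.Finite R (LinearMap.ker p)]
    [Module.Projective R (LinearMap.ker p)] :
    StablyAnnihilates (R ⧸ Ideal.span {f}) (Ideal.Quotient.mk (Ideal.span {f}) (D f))
      (ModuleCat.of (R ⧸ Ideal.span {f}) K) := by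
  have hfK : ∀ k : K, f • k = 0 := smul_eq_zero_of_quotient f
  -- the second fundamental form `θ : F₁ → K`, `u ↦ p (∇ u)`
  let θ : LinearMap.ker p →ₗ[R] K :=
    { toFun := fun u => p (fun i => D ((u : ι → R) i))
      map_add' := fun u u' => by
        have e : (fun i => D (((u + u' : LinearMap.ker p) : ι → R) i)) =
            (fun i => D ((u : ι → R) i)) + fun i => D ((u' : ι → R) i) := by
          funext i; simp
        rw [e, map_add]
      map_smul' := fun r u => by
        have e : (fun i => D (((r • u : LinearMap.ker p) : ι → R) i)) =
            D r • (u : ι → R) + r • fun i => D ((u : ι → R) i) := by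
          rw [Submodule.coe_smul, coord_derivation_smul]
        have hu : p (u : ι → R) = 0 := LinearMap.mem_ker.mp u.2
        rw [e, map_add, map_smul, map_smul, hu, smul_zero, zero_add, RingHom.id_apply] }
  have hθ : ∀ u : LinearMap.ker p, θ u = p (fun i => D ((u : ι → R) i)) := fun u => rfl
  -- `T ⊗_R F₁ → K`
  let θ' : (R ⧸ Ideal.span {f}) ⊗[R] LinearMap.ker p →ₗ[R ⧸ Ideal.span {f}] K :=
    θ.liftBaseChange (R ⧸ Ideal.span {f})
  -- `ι₀ : (ι → R) → T ⊗_R F₁`, `v ↦ 1 ⊗ f v`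
  have hfv : ∀ v : ι → R, f • v ∈ LinearMap.ker p := fun v => by
    rw [LinearMap.mem_ker, map_smul, hfK]
  let ι₀ : (ι → R) →ₗ[R] (R ⧸ Ideal.span {f}) ⊗[R] LinearMap.ker p :=
    { toFun := fun v => (1 : R ⧸ Ideal.span {f}) ⊗ₜ[R] (⟨f • v, hfv v⟩ : LinearMap.ker p)
      map_add' := fun v w => by
        have e : (⟨f • (v + w), hfv (v + w)⟩ : LinearMap.ker p) = ⟨f • v, hfv v⟩ + ⟨f • w, hfv w⟩ := by
          ext1; simp [smul_add]
        rw [e, TensorProduct.tmul_add]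
      map_smul' := fun r v => by
        have e : (⟨f • (r • v), hfv (r • v)⟩ : LinearMap.ker p) = r • ⟨f • v, hfv v⟩ := by
          ext1; simp [smul_comm f r v]
        rw [e, TensorProduct.tmul_smul, RingHom.id_apply] }
  have hι₀ : ∀ v, ι₀ v = (1 : R ⧸ Ideal.span {f}) ⊗ₜ[R] (⟨f • v, hfv v⟩ : LinearMap.ker p) :=
    fun v => rfl
  -- `ι₀` kills `F₁ = ker p`: `1 ⊗ f u = (f • 1) ⊗ u = 0`
  have hker : LinearMap.ker p ≤ LinearMap.ker ι₀ := by
    intro u hu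
    rw [LinearMap.mem_ker, hι₀]
    have e : (⟨f • u, hfv u⟩ : LinearMap.ker p) = f • (⟨u, hu⟩ : LinearMap.ker p) := rfl
    rw [e, ← TensorProduct.smul_tmul, Algebra.smul_def, mul_one, Ideal.Quotient.algebraMap_eq,
      Ideal.Quotient.eq_zero_iff_mem.mpr (Ideal.mem_span_singleton_self f), TensorProduct.zero_tmul]
  -- descend along `p` to `ιR : K → T ⊗_R F₁` (`R`-linear), then make it `T`-linear
  let ιR : K →ₗ[R] (R ⧸ Ideal.span {f}) ⊗[R] LinearMap.ker p :=
    (LinearMap.ker p).liftQ ι₀ hker ∘ₗ (p.quotKerEquivOfSurjective hp).symm.toLinearMap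
  have hιR : ∀ v, ιR (p v) = (1 : R ⧸ Ideal.span {f}) ⊗ₜ[R] (⟨f • v, hfv v⟩ : LinearMap.ker p) := by
    intro v
    have e : (p.quotKerEquivOfSurjective hp).symm (p v) = Submodule.Quotient.mk v := by
      rw [LinearEquiv.symm_apply_eq, LinearMap.quotKerEquivOfSurjective_apply_mk]
    simp only [ιR, LinearMap.coe_comp, Function.comp_apply, LinearEquiv.coe_coe, e,
      Submodule.liftQ_apply, hι₀]
  let ιT : K →ₗ[R ⧸ Ideal.span {f}] (R ⧸ Ideal.span {f}) ⊗[R] LinearMap.ker p :=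
    ιR.extendScalarsOfSurjective (Ideal.Quotient.mk_surjective)
  -- the factorisation through the finitely generated projective `T ⊗_R F₁`
  refine ⟨ModuleCat.of (R ⧸ Ideal.span {f}) ((R ⧸ Ideal.span {f}) ⊗[R] LinearMap.ker p),
    inferInstance, (IsProjective.iff_projective (R := R ⧸ Ideal.span {f}) _).mp inferInstance,
    ModuleCat.ofHom ιT, ModuleCat.ofHom θ', ?_⟩
  ext k
  obtain ⟨v, rfl⟩ := hp k
  have h1 : θ' (ιT (p v)) = Ideal.Quotient.mk (Ideal.span {f}) (D f) • p v := by
    change θ' (ιR (p v)) = _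
    rw [hιR, LinearMap.liftBaseChange_tmul, one_smul, hθ]
    change p (fun i => D ((f • v) i)) = _
    rw [coord_derivation_smul, map_add, map_smul, map_smul, hfK, add_zero,
      ← Ideal.Quotient.algebraMap_eq, algebraMap_smul]
  simpa [ModuleCat.hom_comp, ModuleCat.hom_ofHom] using h1

/-! ## `pd_R K ≤ 1` and the membership in `caᵈ⁺¹(R ⧸ (f))` -/

/-- For `R` noetherian and `K` a finitely generated `R ⧸ (f)`-module with `pd_R K ≤ 1`, the class of
`D f` stably annihilates `K`, for every derivation `D` of `R` (choose `p : Rⁿ ↠ K`; its kernel is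
finitely generated projective). [folklore] -/
theorem stablyAnnihilates_derivation_of_hasProjectiveDimensionLT_two [IsNoetherianRing R]
    (D : Derivation A R R) (f : R) (K : ModuleCat.{u} (R ⧸ Ideal.span {f}))
    [Module.Finite (R ⧸ Ideal.span {f}) K]
    (hK : HasProjectiveDimensionLT
      ((restrictScalarsFunctor R (R ⧸ Ideal.span {f})).obj K) 2) :
    StablyAnnihilates (R ⧸ Ideal.span {f}) (Ideal.Quotient.mk (Ideal.span {f}) (D f)) K := by
  letI : Module R K := Module.compHom K (Ideal.Quotient.mk (Ideal.span {f}))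
  haveI : IsScalarTower R (R ⧸ Ideal.span {f}) K := IsScalarTower.of_algebraMap_smul fun _ _ => rfl
  -- an `R`-free presentation `p : Rⁿ ↠ K`
  obtain ⟨n, g, hg⟩ := Module.Finite.exists_fin' (R ⧸ Ideal.span {f}) K
  let q : (Fin n → R) →ₗ[R] (Fin n → R ⧸ Ideal.span {f}) :=
    (Algebra.linearMap R (R ⧸ Ideal.span {f})).compLeft (Fin n)
  have hq : Function.Surjective q := fun w => by
    choose v hv using fun i => Ideal.Quotient.mk_surjective (w i)
    exact ⟨v, funext fun i => by simp [q, hv]⟩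
  let p : (Fin n → R) →ₗ[R] K := g.restrictScalars R ∘ₗ q
  have hp : Function.Surjective p := hg.comp hq
  -- its kernel is finitely generated projective since `pd_R K ≤ 1`
  haveI : Module.Finite R (LinearMap.ker p) := Module.IsNoetherian.finite R _
  have hS := LinearMap.shortExact_shortComplexKer hp
  haveI : HasProjectiveDimensionLT (ModuleCat.of R K) 2 := hK
  haveI : HasProjectiveDimensionLT (ModuleCat.of R (Fin n → R)) 1 := by
    haveI : Projective (ModuleCat.of R (Fin n → R)) :=
      (IsProjective.iff_projective (R := R) (Fin n → R)).mp inferInstance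
    infer_instance
  have hF₁ : HasProjectiveDimensionLT (ModuleCat.of R (LinearMap.ker p)) 1 :=
    hS.hasProjectiveDimensionLT_X₁ 1 inferInstance inferInstance
  haveI : Projective (ModuleCat.of R (LinearMap.ker p)) := by
    haveI := hF₁; infer_instance
  haveI : Module.Projective R (LinearMap.ker p) :=
    (IsProjective.iff_projective (R := R) (LinearMap.ker p)).mpr inferInstance
  exact stablyAnnihilates_derivation_of_presentation D f K p hp

/-- **KEPT PROPER: the Jacobian ideal lies in `caᵈ⁺¹`.**  Let `R` be noetherian with
`caᵈ⁺²(R) = R` (every finitely generated `R`-module has projective dimension `≤ d + 1`; e.g. `R`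
regular or regular local of dimension `d + 1`), `f ∈ R` a non-zero-divisor and `D` a derivation of
`R`.  Then `(D f)‾ ∈ caᵈ⁺¹(R ⧸ (f))`: by CA1 it suffices that `(D f)‾` stably annihilates every `d`-th
syzygy `K` of every finitely generated `R ⧸ (f)`-module; such `K` has `pd_R ≤ 1` (o9g dimension
shifting through the hypersurface), and the basis-free Eisenbud operator applies.
[folklore; classical «Jacobian ideal ⊆ cohomology annihilator» for hypersurfaces] -/
theorem derivation_mem_cohomologyAnnihilatorOfDegree [IsNoetherianRing R] {d : ℕ}
    (hR : cohomologyAnnihilatorOfDegree R (d + 2) = ⊤) (f : R) (hf : f ∈ nonZeroDivisors R)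
    (D : Derivation A R R) :
    Ideal.Quotient.mk (Ideal.span {f}) (D f) ∈
      cohomologyAnnihilatorOfDegree (R ⧸ Ideal.span {f}) (d + 1) := by
  haveI : IsNoetherianRing (R ⧸ Ideal.span {f}) := Ideal.Quotient.isNoetherianRing _
  rw [mem_cohomologyAnnihilatorOfDegree_succ_iff_forall_isSyzygy]
  intro M K hM hK
  haveI := hM
  haveI : Module.Finite (R ⧸ Ideal.span {f}) K := finite_of_isSyzygy d hM hK
  haveI : Module.Finite R ((restrictScalarsFunctor R (R ⧸ Ideal.span {f})).obj M) :=
    finite_restrictScalars (A := R) (B := R ⧸ Ideal.span {f}) M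
  have hMpd : HasProjectiveDimensionLT
      ((restrictScalarsFunctor R (R ⧸ Ideal.span {f})).obj M) (2 + d) := by
    rw [add_comm]
    exact hasProjectiveDimensionLT_of_cohomologyAnnihilatorOfDegree_eq_top hR _
  have hKpd := hasProjectiveDimensionLT_restrict_of_isSyzygy f hf d hK 2 le_rfl hMpd
  exact stablyAnnihilates_derivation_of_hasProjectiveDimensionLT_two D f K hKpd

/-- `ca`-form: under the same hypotheses `(D f)‾ ∈ ca(R ⧸ (f))`. [folklore] -/
theorem derivation_mem_cohomologyAnnihilator [IsNoetherianRing R] {d : ℕ}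
    (hR : cohomologyAnnihilatorOfDegree R (d + 2) = ⊤) (f : R) (hf : f ∈ nonZeroDivisors R)
    (D : Derivation A R R) :
    Ideal.Quotient.mk (Ideal.span {f}) (D f) ∈ cohomologyAnnihilator (R ⧸ Ideal.span {f}) :=
  cohomologyAnnihilatorOfDegree_le (d + 1) (derivation_mem_cohomologyAnnihilatorOfDegree hR f hf D)

/-- **«Jacobian ⊆ ca» in ideal form**: for any family of derivations `Dᵢ` of `R`, the ideal of
`R ⧸ (f)` spanned by the classes `(Dᵢ f)‾` lies in `caᵈ⁺¹(R ⧸ (f))` (`R` noetherian with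
`caᵈ⁺²(R) = R`, `f` a non-zero-divisor). [folklore] -/
theorem span_derivation_le_cohomologyAnnihilatorOfDegree [IsNoetherianRing R] {d : ℕ}
    (hR : cohomologyAnnihilatorOfDegree R (d + 2) = ⊤) (f : R) (hf : f ∈ nonZeroDivisors R)
    {σ : Type*} (D : σ → Derivation A R R) :
    Ideal.span (Set.range fun i => Ideal.Quotient.mk (Ideal.span {f}) (D i f)) ≤
      cohomologyAnnihilatorOfDegree (R ⧸ Ideal.span {f}) (d + 1) := by
  rw [Ideal.span_le]
  rintro _ ⟨i, rfl⟩
  exact derivation_mem_cohomologyAnnihilatorOfDegree hR f hf (D i)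

/-- **Presented hypersurface stages**: for `T ≃+* R ⧸ (f)` with `R` noetherian, `caᵈ⁺²(R) = R`
and `f` a non-zero-divisor, the image in `T` of `(D f)‾` lies in `caᵈ⁺¹(T)` for every derivation
`D` of `R` (tree `ringEquiv_apply_mem_cohomologyAnnihilatorOfDegree`). This is the shape in which a
tower stage `T_m` presented as a hypersurface consumes KEPT. [folklore] -/
theorem ringEquiv_apply_derivation_mem_cohomologyAnnihilatorOfDegree [IsNoetherianRing R] {d : ℕ}
    (hR : cohomologyAnnihilatorOfDegree R (d + 2) = ⊤) (f : R) (hf : f ∈ nonZeroDivisors R)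
    (D : Derivation A R R) {T : Type u} [CommRing T] (e : (R ⧸ Ideal.span {f}) ≃+* T) :
    e (Ideal.Quotient.mk (Ideal.span {f}) (D f)) ∈ cohomologyAnnihilatorOfDegree T (d + 1) :=
  ringEquiv_apply_mem_cohomologyAnnihilatorOfDegree e
    (derivation_mem_cohomologyAnnihilatorOfDegree hR f hf D)

/-! ## Regular ambient rings -/

/-- `R` a REGULAR LOCAL ring of dimension `d + 1`, `f` a non-zero-divisor, `D` a derivation:
`(D f)‾ ∈ caᵈ⁺¹(R ⧸ (f))`. [folklore] -/
theorem derivation_mem_cohomologyAnnihilatorOfDegree_of_isRegularLocalRing [IsRegularLocalRing R]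
    {d : ℕ} (hd : ringKrullDim R = (d + 1 : ℕ)) (f : R) (hf : f ∈ nonZeroDivisors R)
    (D : Derivation A R R) :
    Ideal.Quotient.mk (Ideal.span {f}) (D f) ∈
      cohomologyAnnihilatorOfDegree (R ⧸ Ideal.span {f}) (d + 1) :=
  derivation_mem_cohomologyAnnihilatorOfDegree
    (cohomologyAnnihilatorOfDegree_eq_top_of_isRegularLocalRing (R := R) hd) f hf D

/-- `R` a REGULAR ring of dimension `≤ d + 1`, `f` a non-zero-divisor, `D` a derivation:
`(D f)‾ ∈ caᵈ⁺¹(R ⧸ (f))`. [folklore] -/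
theorem derivation_mem_cohomologyAnnihilatorOfDegree_of_isRegularRing [IsRegularRing R]
    {d : ℕ} (hd : ringKrullDim R ≤ (d + 1 : ℕ)) (f : R) (hf : f ∈ nonZeroDivisors R)
    (D : Derivation A R R) :
    Ideal.Quotient.mk (Ideal.span {f}) (D f) ∈
      cohomologyAnnihilatorOfDegree (R ⧸ Ideal.span {f}) (d + 1) :=
  derivation_mem_cohomologyAnnihilatorOfDegree
    (cohomologyAnnihilatorOfDegree_eq_top_of_isRegularRing R hd) f hf D

/-! ## The affine hypersurface case `S = k[X₀, …, X_d]` -/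

/-- **Affine hypersurfaces**: for a field `k`, `S = k[X₀,…,X_d]` and `0 ≠ f ∈ S`, every partial
derivative `∂f/∂Xᵢ` lies in `caᵈ⁺¹(S ⧸ (f))` (`S` is regular of dimension `d + 1`; `D := pderiv i`).
This is the form the §H2L specimens consume (`E₈ × line`, `A₃ × line`: `S = k[x,y,z,t]`, `d = 3`).
[folklore] -/
theorem pderiv_mem_cohomologyAnnihilatorOfDegree {k : Type u} [Field k] {d : ℕ}
    (f : MvPolynomial (Fin (d + 1)) k) (hf : f ≠ 0) (i : Fin (d + 1)) :
    Ideal.Quotient.mk (Ideal.span {f}) (MvPolynomial.pderiv i f) ∈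
      cohomologyAnnihilatorOfDegree (MvPolynomial (Fin (d + 1)) k ⧸ Ideal.span {f}) (d + 1) := by
  have hdim : ringKrullDim (MvPolynomial (Fin (d + 1)) k) ≤ ((d + 1 : ℕ) : WithBot ℕ∞) := by
    rw [MvPolynomial.ringKrullDim_of_isNoetherianRing, ringKrullDim_eq_zero_of_field, zero_add,
      Nat.card_eq_fintype_card, Fintype.card_fin]
  exact derivation_mem_cohomologyAnnihilatorOfDegree_of_isRegularRing hdim f
    (mem_nonZeroDivisors_of_ne_zero hf) (MvPolynomial.pderiv i)

/-- **The Jacobian ideal of an affine hypersurface lies in `caᵈ⁺¹`**: for a field `k`,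
`S = k[X₀,…,X_d]`, `0 ≠ f ∈ S`: the ideal of `S ⧸ (f)` generated by the classes of the partials
`∂f/∂Xᵢ` is contained in `caᵈ⁺¹(S ⧸ (f))` (hence in `ca(S ⧸ (f))`). [folklore] -/
theorem jacobian_le_cohomologyAnnihilatorOfDegree {k : Type u} [Field k] {d : ℕ}
    (f : MvPolynomial (Fin (d + 1)) k) (hf : f ≠ 0) :
    Ideal.span (Set.range fun i : Fin (d + 1) =>
        Ideal.Quotient.mk (Ideal.span {f}) (MvPolynomial.pderiv i f)) ≤
      cohomologyAnnihilatorOfDegree (MvPolynomial (Fin (d + 1)) k ⧸ Ideal.span {f}) (d + 1) := by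
  rw [Ideal.span_le]
  rintro _ ⟨i, rfl⟩
  exact pderiv_mem_cohomologyAnnihilatorOfDegree f hf i

end Summit.ResolutionOfSingularities.ResolutionOfSingularities.Theorems.HomologicalConductor.PersistenceJacobianKept
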